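import Literature.NumberTheory.GaloisRepresentations.LocalEulerCharacteristicTrivial
import Literature.NumberTheory.GaloisRepresentations.LocalEulerCharacteristicDevissage
import Literature.NumberTheory.GaloisRepresentations.PPrimaryDevissage
import HarnessLib

/-!
# Tate's local Euler–Poincaré characteristic formula for modules with unipotent action over `K_v`

Topic `NumberTheory/GaloisRepresentations`; namespace `Literature.NumberTheory.GaloisRepresentations`.
Theorems only (no definition, no named fact; D-0026).  Sequel to `LocalEulerCharacteristicMu`,
`LocalEulerCharacteristicDevissage`, `LocalEulerCharacteristicTrivial`: the dévissage "aux modules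
simples … isomorphes à `ℤ/pℤ`" (Serre, *Cohomologie galoisienne*, II §5.7, proof of Thm. 5, with
I §3.3) carried out for the tree's named fact `localEulerPoincareCharacteristic (v.adicCompletion K)`
(Milne *ADT* I Thm. 2.8) on the class of modules where every simple subquotient IS `ℤ/pℤ`:

* `localEulerPoincareCharacteristic_of_pGroup_quotient_adicCompletion` — **the formula
  `#M^Γ · #H²(K_v, M) · #(𝒪[K_v]/(#M)) = #H¹(K_v, M)` (with `H¹`, `H²` finite) holds for every finite
  discrete `p`-primary `Γ_{K_v}`-module `M` on which `Γ_{K_v}` acts through a finite `p`-group**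
  (`N₀ ⊴ Γ_{K_v}` acting trivially, `Γ_{K_v}/N₀` a finite `p`-group): such an `M ≠ 0` has a fixed line
  `ℤ b₁ ≅ ℤ/pℤ` (`exists_ne_zero_forall_apply_eq`, `exists_line`), the formula holds for the line
  (`localEulerPoincareCharacteristic_trivial_prime_adicCompletion`) and for `M/ℤ b₁` by induction on
  `#M`, hence for `M` (`localEulerPoincare_of_isSES`);
* `localEulerPoincareCharacteristic_of_forall_apply_eq_adicCompletion` — in particular for every
  finite `p`-primary module with TRIVIAL `Γ_{K_v}`-action (e.g. `#Hom_cont(Γ_{K_v}, ℤ/p^k)` =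
  `#H¹(K_v, ℤ/p^k) = p^k · #μ_{p^k}(K_v) · #(𝒪_v/p^k)`, the classical count of cyclic extensions).

## References
* J. S. Milne, *Arithmetic Duality Theorems*, 2nd ed. (2006), I Thm. 2.8. [MilneADT2006]
* J.-P. Serre, *Galois Cohomology* (1997), I §3.3, II §5.7 Thm. 5. [SerreGaloisCohomology1997]
-/

noncomputable section

open CategoryTheory Function
open Field IsNonarchimedeanLocalField ValuativeRel

universe u

namespace Literature.NumberTheory.GaloisRepresentations

open _root_.TopRep _root_.ContRepresentation _root_.ContinuousCohomology DiscreteGaloisModule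
open NumberField IsDedekindDomain

section Unipotent

variable (K : Type u) [Field K] [NumberField K] (v : HeightOneSpectrum (𝓞 K))

/-- **Tate's local Euler–Poincaré characteristic formula over `K_v` for `p`-primary modules with
action through a finite `p`-group** (Milne I Thm. 2.8 on this class; Serre II §5.7, dévissage to
`ℤ/pℤ`): if `N₀ ⊴ Γ_{K_v}` acts trivially on the finite discrete `p`-primary module `M` and
`Γ_{K_v}/N₀` is a finite `p`-group, then `H¹(K_v, M)`, `H²(K_v, M)` are finite and
`#M^Γ · #H²(K_v, M) · #(𝒪[K_v]/(#M)) = #H¹(K_v, M)`.  Induction on `#M` through a fixed line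
`ℤ/pℤ ⊆ M` (`exists_ne_zero_forall_apply_eq`, `exists_line`, `isSES_subtype_mkQ`), the line case
(`localEulerPoincareCharacteristic_trivial_prime_adicCompletion`) and the dévissage step
(`localEulerPoincare_of_isSES`). [cite: MilneADT2006, Ch. I §2, Thm. 2.8 (p. 31)]
[cite: SerreGaloisCohomology1997, II §5.7 Thm. 5 (proof) and I §3.3] -/
theorem localEulerPoincareCharacteristic_of_pGroup_quotient_adicCompletion {p : ℕ} [hp : Fact p.Prime]
    (N₀ : Subgroup (absoluteGaloisGroup (v.adicCompletion K))) [N₀.Normal]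
    [Finite (absoluteGaloisGroup (v.adicCompletion K) ⧸ N₀)]
    (hQ : IsPGroup p (absoluteGaloisGroup (v.adicCompletion K) ⧸ N₀))
    (M : Type u) [AddCommGroup M] [TopologicalSpace M] [DiscreteTopology M] [Finite M]
    (ρ : ContinuousRep (absoluteGaloisGroup (v.adicCompletion K)) ℤ M) (hM : IsPrimaryTorsion p M)
    (hN₀ : ∀ g ∈ N₀, ∀ m : M, ρ g m = m) :
    Finite (continuousCohomology 1 ρ.toTopRep) ∧ Finite (continuousCohomology 2 ρ.toTopRep) ∧
      Nat.card ρ.toTopRep.ρ.invariants * Nat.card (continuousCohomology 2 ρ.toTopRep) *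
          Nat.card (𝒪[v.adicCompletion K] ⧸
            Ideal.span {((Nat.card M : ℕ) : 𝒪[v.adicCompletion K])}) =
        Nat.card (continuousCohomology 1 ρ.toTopRep) := by
  classical
  haveI : CharZero (v.adicCompletion K) :=
    charZero_of_injective_algebraMap (algebraMap K _).injective
  suffices key : ∀ (n : ℕ) (B : Type u) [AddCommGroup B] [TopologicalSpace B] [DiscreteTopology B]
      [Finite B] (τ : ContinuousRep (absoluteGaloisGroup (v.adicCompletion K)) ℤ B),
      IsPrimaryTorsion p B → (∀ g ∈ N₀, ∀ b : B, τ g b = b) → Nat.card B = n →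
      Finite (continuousCohomology 1 τ.toTopRep) ∧ Finite (continuousCohomology 2 τ.toTopRep) ∧
        Nat.card τ.toTopRep.ρ.invariants * Nat.card (continuousCohomology 2 τ.toTopRep) *
            Nat.card (𝒪[v.adicCompletion K] ⧸
              Ideal.span {((Nat.card B : ℕ) : 𝒪[v.adicCompletion K])}) =
          Nat.card (continuousCohomology 1 τ.toTopRep) from key _ M ρ hM hN₀ rfl
  intro n
  induction n using Nat.strong_induction_on with
  | _ n ih =>
    intro B _ _ _ _ τ hB hN₀ hn
    by_cases hsub : Subsingleton B
    · -- the zero module: all counts are `1`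
      haveI h1 : Subsingleton (continuousCohomology 1 τ.toTopRep) :=
        subsingleton_continuousCohomology_of_subsingleton τ.toTopRep 0
      haveI h2 : Subsingleton (continuousCohomology 2 τ.toTopRep) :=
        subsingleton_continuousCohomology_of_subsingleton τ.toTopRep 1
      have hB1 : Nat.card B = 1 := Nat.card_of_subsingleton (0 : B)
      have hI : Ideal.span {((Nat.card B : ℕ) : 𝒪[v.adicCompletion K])} = ⊤ := by
        rw [hB1, Nat.cast_one, Ideal.span_singleton_one]
      haveI : Subsingleton (𝒪[v.adicCompletion K] ⧸
          Ideal.span {((Nat.card B : ℕ) : 𝒪[v.adicCompletion K])}) := by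
        rw [hI]
        exact Ideal.Quotient.subsingleton_iff.mpr rfl
      refine ⟨Finite.of_subsingleton, Finite.of_subsingleton, ?_⟩
      rw [Nat.card_of_subsingleton (0 : τ.toTopRep.ρ.invariants),
        Nat.card_of_subsingleton (0 : continuousCohomology 2 τ.toTopRep),
        Nat.card_of_subsingleton (0 : continuousCohomology 1 τ.toTopRep),
        Nat.card_of_subsingleton (0 : 𝒪[v.adicCompletion K] ⧸
          Ideal.span {((Nat.card B : ℕ) : 𝒪[v.adicCompletion K])})]
    · haveI : Nontrivial B := not_subsingleton_iff_nontrivial.1 hsub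
      obtain ⟨b, hb0, hbfix⟩ := exists_ne_zero_forall_apply_eq N₀ hQ τ hB hN₀
      obtain ⟨b₁, hb₁0, hpb₁, hb₁fix⟩ := exists_line τ hB b hb0 hbfix
      let W₁ : Submodule ℤ B := Submodule.span ℤ {b₁}
      have hW₁ : ∀ g, W₁ ≤ W₁.comap (τ g) := span_singleton_le_comap τ b₁ hb₁fix
      have hSES := isSES_subtype_mkQ τ W₁ hW₁
      have hcardW : Nat.card W₁ = p := natCard_span_singleton b₁ hb₁0 hpb₁
      haveI : Finite W₁ := Nat.finite_of_card_ne_zero (by rw [hcardW]; exact hp.out.ne_zero)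
      -- the line `ℤ b₁ ≅ ℤ/pℤ` (trivial action)
      have h₁ := localEulerPoincareCharacteristic_trivial_prime_adicCompletion K v
        (τ.subrepresentation W₁ hW₁) hcardW (subrepresentation_span_apply τ b₁ hb₁fix)
      -- the quotient, by induction
      haveI : Finite (B ⧸ W₁) := Finite.of_surjective _ (Submodule.Quotient.mk_surjective W₁)
      have hlt : Nat.card (B ⧸ W₁) < n := by
        have hmul : Nat.card B = Nat.card (B ⧸ W₁) * Nat.card W₁ :=
          AddSubgroup.card_eq_card_quotient_mul_card_addSubgroup W₁.toAddSubgroup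
        rw [hn, hcardW] at hmul
        rw [hmul]
        exact (Nat.lt_mul_iff_one_lt_right Nat.card_pos).2 hp.out.one_lt
      have htriv : ∀ g ∈ N₀, ∀ x : B ⧸ W₁, τ.quotient W₁ hW₁ g x = x := fun g hg x => by
        induction x using Submodule.Quotient.induction_on with
        | _ m => rw [ContinuousRep.quotient_apply_mk, hN₀ g hg m]
      have h₃ := ih _ hlt (B ⧸ W₁) (τ.quotient W₁ hW₁) (hB.quotient W₁) htriv rfl
      exact localEulerPoincare_of_isSES (v.adicCompletion K) hSES hB h₁.2.2 h₃.2.2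

/-- **Tate's local Euler–Poincaré characteristic formula over `K_v` for finite `p`-primary modules
with trivial action** (e.g. `M = ℤ/p^k`: `#H¹(K_v, ℤ/p^k) = #H⁰ · #H² · #(𝒪_v/p^k)`): the case
`N₀ = Γ_{K_v}` of `localEulerPoincareCharacteristic_of_pGroup_quotient_adicCompletion`.
[cite: MilneADT2006, Ch. I §2, Thm. 2.8 (p. 31)] [cite: SerreGaloisCohomology1997, II §5.7 Thm. 5] -/
theorem localEulerPoincareCharacteristic_of_forall_apply_eq_adicCompletion {p : ℕ} [Fact p.Prime]
    (M : Type u) [AddCommGroup M] [TopologicalSpace M] [DiscreteTopology M] [Finite M]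
    (ρ : ContinuousRep (absoluteGaloisGroup (v.adicCompletion K)) ℤ M) (hM : IsPrimaryTorsion p M)
    (hρ : ∀ (g : absoluteGaloisGroup (v.adicCompletion K)) (m : M), ρ g m = m) :
    Finite (continuousCohomology 1 ρ.toTopRep) ∧ Finite (continuousCohomology 2 ρ.toTopRep) ∧
      Nat.card ρ.toTopRep.ρ.invariants * Nat.card (continuousCohomology 2 ρ.toTopRep) *
          Nat.card (𝒪[v.adicCompletion K] ⧸
            Ideal.span {((Nat.card M : ℕ) : 𝒪[v.adicCompletion K])}) =
        Nat.card (continuousCohomology 1 ρ.toTopRep) := by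
  haveI : Subsingleton (absoluteGaloisGroup (v.adicCompletion K) ⧸
      (⊤ : Subgroup (absoluteGaloisGroup (v.adicCompletion K)))) :=
    QuotientGroup.subsingleton_quotient_top
  haveI : Finite (absoluteGaloisGroup (v.adicCompletion K) ⧸
      (⊤ : Subgroup (absoluteGaloisGroup (v.adicCompletion K)))) :=
    Finite.of_subsingleton
  have hQ : IsPGroup p (absoluteGaloisGroup (v.adicCompletion K) ⧸
      (⊤ : Subgroup (absoluteGaloisGroup (v.adicCompletion K)))) :=
    IsPGroup.of_card (n := 0) (by
      rw [pow_zero]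
      exact Nat.card_of_subsingleton (1 : absoluteGaloisGroup (v.adicCompletion K) ⧸
        (⊤ : Subgroup (absoluteGaloisGroup (v.adicCompletion K)))))
  exact localEulerPoincareCharacteristic_of_pGroup_quotient_adicCompletion K v ⊤
    hQ M ρ hM (fun g _ m => hρ g m)

end Unipotent

end Literature.NumberTheory.GaloisRepresentations

end
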